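import Summits.QuantumFields.GaugeBoot.LoopClasses
import Summits.QuantumFields.GaugeBoot.LoopEquationSchema
import HarnessLib

/-!
# Positioned PAIRS of loops: the expectation `⟨W_x(A)·W_y(B)⟩` and its symmetry class (cell `gauge-boot`)

Honest framing (cell rule): certified bounds on lattice expectations at stated coupling, gauge group, dimension and
torus size; NOT a mass gap, NOT a continuum limit, NOT a string tension; not summit-bearing
(`FixedCouplingUltralocality`, `PerturbativeInvisibility`).

`LoopClasses.lean` (lean1) identifies SINGLE loop variables `⟨W_0(w)⟩` along hyperoctahedral moves, reversal, rotation
and backtrack reduction.  The `SU(2)` TRACE rows of the generators (eng1 G1 `su2_trace_rows`: `w(O) + w(C₁·C₂⁻¹) =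
2·d(C₁,C₂)` at every self-intersection of a loop `O = C₁·C₂`, the double trace `d(C₁,C₂) = ⟨W_v(C₁)·W_v(C₂)⟩` then
eliminated between two decompositions with the same POSITIONED-PAIR class) need the same identification for products
of two loop variables read from two (integer) base points.  This file provides it, script-style, so that each use is
ONE `decide`:

* `PLoop d` = integer base point + word; `pairExp ρ β L p q = ⟨W_{p}·W_{q}⟩` on the torus `(ℤ/L)^d` (base points cast
  by `castZ`);
* `PMove`: joint translation, joint axis permutation, joint reflection of axis `0` (measure symmetries, tree
  `wilsonExpectation_comp_torusConfigShift / _configPerm / _negReflect`), and — on either component — reversal,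
  one-letter rotation (base point moves along the loop) and free reduction (pointwise identities of `WordLoop` /
  `LoopClasses`);
* `PMove.run` executes a script on a pair, `PMove.closedAlong` checks (decidably) that every reversal / rotation is
  applied to a closed component, and `pairExp_run` : the pair expectation is invariant along any such script, on every
  torus and at every coupling — G1's `canonical_multiloop` key (global translation × B_d, independent rotation /
  reversal / reduction) is a special case.
Everything is `[folklore]`.
-/

noncomputable section

open MeasureTheory
open Literature.MathematicalPhysics.QuantumFieldTheory

namespace Summit.QuantumFields.GaugeBoot

/-- A positioned loop: an integer base point and a word (read from the base point). [folklore] -/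
structure PLoop (d : ℕ) where
  /-- base point in `ℤ^d` (cast to the torus by `castZ`) -/
  base : Fin d → ℤ
  /-- the word -/
  word : Word d

namespace PLoop

variable {d : ℕ}

/-- Extensionality for positioned loops. [folklore] -/
theorem ext_iff' (p q : PLoop d) : p = q ↔ p.base = q.base ∧ p.word = q.word := by
  constructor
  · rintro rfl; exact ⟨rfl, rfl⟩
  · rcases p with ⟨b, w⟩; rcases q with ⟨b', w'⟩; rintro ⟨h₁, h₂⟩; cases h₁; cases h₂; rfl

/-- Decidable equality by components (kernel-reducible: no `Eq.rec` in the decision procedure, so that `decide`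
can run pair scripts). [folklore] -/
instance instDecidableEq : DecidableEq (PLoop d) := fun p q =>
  decidable_of_iff (p.base = q.base ∧ p.word = q.word) (ext_iff' p q).symm

/-- Integer action of an axis permutation on base points (matches the tree's `sitePerm`). [folklore] -/
def permZ (π : Equiv.Perm (Fin d)) (b : Fin d → ℤ) : Fin d → ℤ := fun k => b (π.symm k)

/-- Integer action of the reflection of axis `0` on base points (matches the tree's `Site.negReflect`). [folklore] -/
def refl0Z [NeZero d] (b : Fin d → ℤ) : Fin d → ℤ := fun k => if k = 0 then -b k else b k

/-- Joint translation. [folklore] -/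
def shift (t : Fin d → ℤ) (p : PLoop d) : PLoop d := ⟨p.base + t, p.word⟩

/-- Joint axis permutation. [folklore] -/
def perm (π : Equiv.Perm (Fin d)) (p : PLoop d) : PLoop d := ⟨permZ π p.base, p.word.map (Step.permute π)⟩

/-- Joint reflection of axis `0`. [folklore] -/
def refl0 [NeZero d] (p : PLoop d) : PLoop d := ⟨refl0Z p.base, p.word.map Step.reflect0⟩

/-- Reversal of the word (same base point). [folklore] -/
def rev (p : PLoop d) : PLoop d := ⟨p.base, Word.reverse p.word⟩

/-- One-letter cyclic rotation: the first letter moves to the end and the base point moves along it. [folklore] -/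
def rot (p : PLoop d) : PLoop d :=
  match p.word with
  | [] => p
  | s :: w => ⟨p.base + s.disp, w ++ [s]⟩

/-- Free reduction of the word (same base point). [folklore] -/
def red (p : PLoop d) : PLoop d := ⟨p.base, Word.freeReduce p.word⟩

/-- The word is closed (zero net displacement) — decidable. [folklore] -/
def Closed (p : PLoop d) : Prop := Word.disp p.word = 0

/-- `Closed` is decidable (equality of integer vectors). [folklore] -/
instance (p : PLoop d) : Decidable p.Closed := inferInstanceAs (Decidable (_ = _))

end PLoop

/-- The moves of a pair script. [folklore] -/
inductive PMove (d : ℕ) : Type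
  | shift (t : Fin d → ℤ)
  | perm (π : Equiv.Perm (Fin d))
  | refl0
  | revL | revR | rotL | rotR | redL | redR

namespace PMove

variable {d : ℕ} [NeZero d]

/-- One move applied to a pair. [folklore] -/
def apply : PMove d → PLoop d × PLoop d → PLoop d × PLoop d
  | shift t, (p, q) => (p.shift t, q.shift t)
  | perm π, (p, q) => (p.perm π, q.perm π)
  | refl0, (p, q) => (p.refl0, q.refl0)
  | revL, (p, q) => (p.rev, q)
  | revR, (p, q) => (p, q.rev)
  | rotL, (p, q) => (p.rot, q)
  | rotR, (p, q) => (p, q.rot)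
  | redL, (p, q) => (p.red, q)
  | redR, (p, q) => (p, q.red)

/-- The side condition of a move: reversal and rotation act on a CLOSED component. [folklore] -/
def ok : PMove d → PLoop d × PLoop d → Prop
  | revL, (p, _) => p.Closed
  | rotL, (p, _) => p.Closed
  | revR, (_, q) => q.Closed
  | rotR, (_, q) => q.Closed
  | _, _ => True

/-- The side condition is decidable (by cases on the move; kernel-reducible). [folklore] -/
instance instDecidableOk : ∀ (m : PMove d) (pq : PLoop d × PLoop d), Decidable (m.ok pq)
  | shift _, _ => instDecidableTrue
  | perm _, _ => instDecidableTrue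
  | refl0, _ => instDecidableTrue
  | revL, (p, _) => inferInstanceAs (Decidable p.Closed)
  | revR, (_, q) => inferInstanceAs (Decidable q.Closed)
  | rotL, (p, _) => inferInstanceAs (Decidable p.Closed)
  | rotR, (_, q) => inferInstanceAs (Decidable q.Closed)
  | redL, _ => instDecidableTrue
  | redR, _ => instDecidableTrue

/-- Run a script (first move first). [folklore] -/
def run : List (PMove d) → PLoop d × PLoop d → PLoop d × PLoop d
  | [], pq => pq
  | m :: ms, pq => run ms (m.apply pq)

/-- Every move of the script meets its side condition along the run — decidable. [folklore] -/
def closedAlong : List (PMove d) → PLoop d × PLoop d → Prop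
  | [], _ => True
  | m :: ms, pq => m.ok pq ∧ closedAlong ms (m.apply pq)

/-- `closedAlong` is decidable (structural recursion on the script). [folklore] -/
instance : ∀ (ms : List (PMove d)) (pq : PLoop d × PLoop d), Decidable (closedAlong ms pq)
  | [], _ => inferInstanceAs (Decidable True)
  | m :: ms, pq =>
    haveI := instDecidableClosedAlong ms (m.apply pq)
    inferInstanceAs (Decidable (_ ∧ _))

end PMove

section Expectation

variable {d L N : ℕ} [NeZero d] [NeZero L] {G : Type*} [Group G] [TopologicalSpace G] [IsTopologicalGroup G]
  [CompactSpace G] [MeasurableSpace G] [BorelSpace G] (ρ : G →* Matrix (Fin N) (Fin N) ℂ)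

/-- **The pair expectation** `⟨W_p·W_q⟩ = ∫ W_{p.base}(p.word)·W_{q.base}(q.word) dμ_β` on the torus `(ℤ/L)^d`
(G1's double trace `d(C₁,C₂)`; base points cast from `ℤ^d`). [folklore] -/
def pairExp (β : ℝ) (L : ℕ) [NeZero L] (p q : PLoop d) : ℝ :=
  wilsonExpectation ρ β fun U : GaugeConfig d L G =>
    wordLoop ρ (castZ p.base) p.word U * wordLoop ρ (castZ q.base) q.word U

omit [NeZero d] in
/-- `⟨W_p W_q⟩ = ⟨W_q W_p⟩`. [folklore] -/
theorem pairExp_comm (β : ℝ) (p q : PLoop d) : pairExp (G := G) ρ β L p q = pairExp ρ β L q p := by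
  unfold pairExp
  simp_rw [mul_comm]

omit [NeZero d] [NeZero L] in
/-- `castZ` of a sum with a step displacement is the stepped site. [folklore] -/
theorem castZ_add_disp (b : Fin d → ℤ) (s : Step d) : (castZ (b + s.disp) : Site d L) = s.apply (castZ b) := by
  rw [Step.apply_eq_add_disp, castZ_add]
  rfl

omit [NeZero d] in
open TorusTranslation in
/-- **Joint translation invariance.** [folklore] -/
theorem pairExp_shift (β : ℝ) (t : Fin d → ℤ) (p q : PLoop d) :
    pairExp (G := G) ρ β L (p.shift t) (q.shift t) = pairExp ρ β L p q := by
  unfold pairExp PLoop.shift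
  have h := wilsonExpectation_comp_torusConfigShift (d := d) (L := L) (G := G) ρ β (castZ t)
    (fun U => wordLoop ρ (castZ (p.base + t)) p.word U * wordLoop ρ (castZ (q.base + t)) q.word U)
  rw [← h]
  congr 1
  funext U
  simp only [Function.comp_apply, wordLoop, wordHolonomy_torusConfigShift, castZ_add, add_sub_cancel_right]

omit [NeZero d] [NeZero L] in
/-- `sitePerm` on cast integer points. [folklore] -/
theorem sitePerm_castZ (π : Equiv.Perm (Fin d)) (b : Fin d → ℤ) :
    sitePerm π (castZ b : Site d L) = castZ (PLoop.permZ π b) := by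
  funext k; simp [castZ, PLoop.permZ]

omit [NeZero d] in
/-- **Joint axis-permutation invariance.** [folklore] -/
theorem pairExp_perm (hρ : Continuous ρ) (β : ℝ) (π : Equiv.Perm (Fin d)) (p q : PLoop d) :
    pairExp (G := G) ρ β L (p.perm π) (q.perm π) = pairExp ρ β L p q := by
  unfold pairExp PLoop.perm
  have h := wilsonExpectation_comp_configPerm (d := d) (L := L) (G := G) ρ hρ β π
    (fun U => wordLoop ρ (castZ (PLoop.permZ π p.base)) (p.word.map (Step.permute π)) U *
      wordLoop ρ (castZ (PLoop.permZ π q.base)) (q.word.map (Step.permute π)) U)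
  rw [← h]
  congr 1
  funext U
  have hx : ∀ b : Fin d → ℤ, sitePerm π.symm (castZ (PLoop.permZ π b) : Site d L) = castZ b := fun b => by
    rw [← sitePerm_castZ]; ext k; simp
  have hw : ∀ w : Word d, (w.map (Step.permute π)).map (Step.permute π.symm) = w := fun w => by
    rw [List.map_map]
    conv_rhs => rw [← List.map_id w]
    exact List.map_congr_left fun s _ => by simp
  simp only [Function.comp_apply, wordLoop, wordHolonomy_configPerm, hx, hw]

omit [NeZero L] in
/-- `negReflect` on cast integer points. [folklore] -/
theorem negReflect_castZ (b : Fin d → ℤ) : (castZ b : Site d L).negReflect = castZ (PLoop.refl0Z b) := by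
  funext k
  by_cases hk : k = 0
  · subst hk; simp [castZ, PLoop.refl0Z]
  · rw [WilsonSiteRP.negReflect_apply_of_ne _ hk]; simp [castZ, PLoop.refl0Z, hk]

/-- **Joint reflection invariance** (axis `0`). [folklore] -/
theorem pairExp_refl0 (hρ : Continuous ρ) (β : ℝ) (p q : PLoop d) :
    pairExp (G := G) ρ β L p.refl0 q.refl0 = pairExp ρ β L p q := by
  unfold pairExp PLoop.refl0
  have h := wilsonExpectation_comp_negReflect (d := d) (L := L) (G := G) ρ hρ β
    (fun U => wordLoop ρ (castZ (PLoop.refl0Z p.base)) (p.word.map Step.reflect0) U *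
      wordLoop ρ (castZ (PLoop.refl0Z q.base)) (q.word.map Step.reflect0) U)
  rw [← h]
  congr 1
  funext U
  have hx : ∀ b : Fin d → ℤ, (castZ (PLoop.refl0Z b) : Site d L).negReflect = castZ b := fun b => by
    rw [← negReflect_castZ, WilsonSiteRP.negReflect_negReflect]
  have hw : ∀ w : Word d, (w.map Step.reflect0).map Step.reflect0 = w := fun w => by
    rw [List.map_map]
    conv_rhs => rw [← List.map_id w]
    exact List.map_congr_left fun s _ => by simp
  simp only [Function.comp_apply, wordLoop, wordHolonomy_negReflect, hx, hw]

omit [NeZero d] in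
/-- **Reversal of a closed component** (pointwise, `wordLoop_reverse`). [folklore] -/
theorem pairExp_rev_left (hρ : Continuous ρ) (β : ℝ) (p q : PLoop d) (hp : p.Closed) :
    pairExp (G := G) ρ β L p.rev q = pairExp ρ β L p q := by
  unfold pairExp PLoop.rev
  simp only [wordLoop_reverse ρ hρ _ _ (Word.endpoint_eq_self_of_disp _ hp)]

omit [NeZero d] in
/-- **Rotation of a closed component by one letter** (pointwise, `wordLoop_rotate`). [folklore] -/
theorem pairExp_rot_left (β : ℝ) (p q : PLoop d) (hp : p.Closed) :
    pairExp (G := G) ρ β L p.rot q = pairExp ρ β L p q := by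
  unfold pairExp PLoop.rot
  rcases p with ⟨b, w⟩
  cases w with
  | nil => rfl
  | cons s w =>
    simp only
    rw [castZ_add_disp]
    simp only [← wordLoop_rotate ρ (castZ b) s w (Word.endpoint_eq_self_of_disp _ hp)]

omit [NeZero d] in
/-- **Free reduction of a component** (pointwise, `wordLoop_freeReduce`). [folklore] -/
theorem pairExp_red_left (β : ℝ) (p q : PLoop d) :
    pairExp (G := G) ρ β L p.red q = pairExp ρ β L p q := by
  unfold pairExp PLoop.red
  simp only [wordLoop_freeReduce]

/-- One admissible move preserves the pair expectation. [folklore] -/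
theorem pairExp_apply (hρ : Continuous ρ) (β : ℝ) (m : PMove d) (pq : PLoop d × PLoop d) (hm : m.ok pq) :
    pairExp (G := G) ρ β L (m.apply pq).1 (m.apply pq).2 = pairExp ρ β L pq.1 pq.2 := by
  rcases pq with ⟨p, q⟩
  cases m with
  | shift t => exact pairExp_shift ρ β t p q
  | perm π => exact pairExp_perm ρ hρ β π p q
  | refl0 => exact pairExp_refl0 ρ hρ β p q
  | revL => exact pairExp_rev_left ρ hρ β p q hm
  | revR => rw [PMove.apply, pairExp_comm, pairExp_rev_left ρ hρ β q p hm, pairExp_comm]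
  | rotL => exact pairExp_rot_left ρ β p q hm
  | rotR => rw [PMove.apply, pairExp_comm, pairExp_rot_left ρ β q p hm, pairExp_comm]
  | redL => exact pairExp_red_left ρ β p q
  | redR => rw [PMove.apply, pairExp_comm, pairExp_red_left ρ β q p, pairExp_comm]

/-- **Master identification lemma for positioned pairs.** A script of joint translations / axis permutations /
reflections and per-component reversals, rotations and reductions, whose side conditions hold along the run
(`closedAlong`, decidable), preserves `⟨W_p·W_q⟩` on every torus and at every coupling. [folklore] -/
theorem pairExp_run (hρ : Continuous ρ) (β : ℝ) :
    ∀ (ms : List (PMove d)) (pq : PLoop d × PLoop d), PMove.closedAlong ms pq →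
      pairExp (G := G) ρ β L (PMove.run ms pq).1 (PMove.run ms pq).2 = pairExp ρ β L pq.1 pq.2
  | [], _, _ => rfl
  | m :: ms, pq, h => by
    rw [PMove.run, pairExp_run hρ β ms (m.apply pq) h.2, pairExp_apply ρ hρ β m pq h.1]

/-- **Two positioned pairs joined by a checked script have the same expectation.** [folklore] -/
theorem pairExp_eq_of_run (hρ : Continuous ρ) (β : ℝ) (ms : List (PMove d)) (p q p' q' : PLoop d)
    (h : PMove.closedAlong ms (p, q) ∧ PMove.run ms (p, q) = (p', q')) :
    pairExp (G := G) ρ β L p q = pairExp ρ β L p' q' := by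
  have := pairExp_run (L := L) (G := G) ρ hρ β ms (p, q) h.1
  rw [h.2] at this
  exact this.symm

end Expectation

end Summit.QuantumFields.GaugeBoot

end
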